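import Summits.NavierStokesRegularity.NavierStokesRegularity.Theorems.AxisymmetricExtremalityAxisymmetricKatoGlobalStubSeregin2020TypeIILemma22MoserIterationI
import Summits.NavierStokesRegularity.NavierStokesRegularity.Theorems.AxisTwistDoorAveragedConeLiouvilleNUDefs
import HarnessLib

/-!
# Nazarov–Uraltseva 2011, Cor. 3.2 (propagation of positivity, N4 of cell pub/ns-inputs), piece P3 = N-M2:
# the Moser iteration, conclusion (i) — `nu_smallSublevel_lowerBound_i_of_moserStep`

Axis-free TWIN of the A1 file `…Lemma22MoserIterationI` (seat ns-in-ser-c, Seregin 2020 Lemma 2.2 ⇐ N–U 2012): the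
standing hypotheses are `NUStanding Φ U k R N` of `…NUDefs` (A1's `Standing` minus the axis set `S`, energy class
WITHOUT the axis integral) BY NAME, in the hypothesis `hM1` (= `Sig.nu_moserStep` of the N4 skeleton
`kits/N4-skeleton.lean` 5372b51f971b2f9d, landed as `NU.nu_moserStep`) as well as in the conclusion
(= `Sig.nu_smallSublevel_lowerBound`); proofs verbatim (the Moser iteration `p_m = (5/3)^m` over
`…Lemma22MoserIterationTools` BY NAME), theorem names prefixed `nu_`.  Width seat ns-in-wu-341 g2 (plan g6 ruling
11:46:01Z: wu-341 → P3).

## References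

* A. I. Nazarov, N. N. Uraltseva, Algebra i Analiz 23:1 (2011) = St. Petersburg Math. J. 23 (2012) 93–115 =
  arXiv:1011.1888, §3, Lemma 3.1, Cor. 3.1 (2), Remark 6. [NazarovUraltseva2011HarnackDivFree] [NazarovUraltseva2012]
* Z. Lei, X. Ren, G. Tian, arXiv:2501.08976, Lemma 2.5. [LeiRenTian2025]

WHAT THIS IS NOT: not a statement about Navier–Stokes regularity; one piece (P3) of the discharge of the NAMED fact
`NazarovUraltseva2011_positivity_propagation` (INPUT N4); nothing is closed by this file.
-/

-- the problem directory repeats the summit name (D-0017); core's `dupNamespace` linter fires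
set_option linter.dupNamespace false

noncomputable section

open MeasureTheory Set Function Filter Topology TopologicalSpace Metric
open scoped NNReal ENNReal

namespace Summit.NavierStokesRegularity.NavierStokesRegularity.Theorems.AveragedConeLiouville.NU

open Literature.Analysis.FluidPDE Literature.Analysis.FluidPDE.Seregin2020
open Summit.NavierStokesRegularity.NavierStokesRegularity.Theorems.AxisymmetricKatoGlobal.EulerScaling
open Summit.NavierStokesRegularity.NavierStokesRegularity.Theorems.AveragedConeLiouville.NUPositivity

set_option maxHeartbeats 800000 in
-- as in the A1 original (one long Moser-iteration bookkeeping proof)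
/-- **N–U Lemma 3.1 / Cor 3.1 (2), conclusion (i), from the one-step estimate M1.** See the
module docstring. [cite: NazarovUraltseva2012, Lemma 3.1 and Cor 3.1 (2), proof ((3.6) iterated)] -/
theorem nu_smallSublevel_lowerBound_i_of_moserStep
    (hM1 : ∀ (N : ℝ≥0) (Θmax : ℝ), 0 < Θmax → ∃ C₀ A : ℝ, 0 ≤ C₀ ∧ 0 ≤ A ∧ ∀ (Φ : ℝ → EuclideanSpace ℝ (Fin 3) → ℝ) (U : ℝ → EuclideanSpace ℝ (Fin 3) → EuclideanSpace ℝ (Fin 3)) (k R : ℝ), NUStanding Φ U k R N → ∀ (ρ Λ₁ Λ₂ Θ₁ Θ₂ dl dθ t₀ l q : ℝ), R / 4 ≤ ρ → 1 ≤ Λ₂ → Λ₂ + dl ≤ Λ₁ → Λ₁ * ρ ≤ 2 * R → 0 < dl → dl ≤ 1 → 0 < Θ₂ → Θ₂ + dθ ≤ Θ₁ → Θ₁ ≤ Θmax → 0 < dθ → dθ ≤ 1 → t₀ ≤ 0 → -R ^ 2 < t₀ - Θ₁ * ρ ^ 2 → 0 < l → l ≤ k → 2 < q → (∫⁻ z in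 Ioo (t₀ - Θ₂ * ρ ^ 2) t₀ ×ˢ ball (0 : EuclideanSpace ℝ (Fin 3)) (Λ₂ * ρ), ENNReal.ofReal (max (l - Φ z.1 z.2) 0 ^ (5 / 3 * q)) ≤ ENNReal.ofReal (C₀ * (dl * dθ) ^ (-A) * ρ ^ (-(10 / 3 : ℝ))) * (∫⁻ z in Ioo (t₀ - Θ₁ * ρ ^ 2) t₀ ×ˢ ball (0 : EuclideanSpace ℝ (Fin 3)) (Λ₁ * ρ), ENNReal.ofReal (max (l - Φ z.1 z.2) 0 ^ q)) ^ (5 / 3 : ℝ)) ∧ ((∀ᵐ x ∂(volume.restrict (ball (0 : EuclideanSpace ℝ (Fin 3)) (Λ₁ * ρ))), l ≤ Φ (t₀ - Θ₁ * ρ ^ 2) x) → ∫⁻ z in Ioo (t₀ - Θ₁ * ρ ^ 2) t₀ ×ˢ ball (0 : EuclideanSpace ℝ (Fin 3)) (Λ₂ * ρ), ENNReal.ofReal (max (l - Φ z.1 z.2) 0 ^ (5 / 3 * q)) ≤ ENNReal.ofReal (C₀ * dl ^ (-A) * ρ ^ (-(10 / 3 : ℝ))) * (∫⁻ z in Ioo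 (t₀ - Θ₁ * ρ ^ 2) t₀ ×ˢ ball (0 : EuclideanSpace ℝ (Fin 3)) (Λ₁ * ρ), ENNReal.ofReal (max (l - Φ z.1 z.2) 0 ^ q)) ^ (5 / 3 : ℝ))) :
    ∀ (lamlo θlo θhi : ℝ) (N : ℝ≥0), 1 < lamlo → lamlo ≤ 2 → 0 < θlo → θlo ≤ θhi →
    ∃ μ₁ : ℝ, 0 < μ₁ ∧
    ∀ (Φ : ℝ → EuclideanSpace ℝ (Fin 3) → ℝ) (U : ℝ → EuclideanSpace ℝ (Fin 3) → EuclideanSpace ℝ (Fin 3))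
      (k R : ℝ), NUStanding Φ U k R N →
    ∀ (lam ρ θ t₀ l : ℝ), lamlo ≤ lam → lam ≤ 2 → R / 4 ≤ ρ → lam * ρ ≤ 2 * R → θlo ≤ θ → θ ≤ θhi →
      t₀ ≤ 0 → -R ^ 2 < t₀ - θ * ρ ^ 2 → 0 < l → l ≤ k →
      volume {z : ℝ × EuclideanSpace ℝ (Fin 3) |
          z ∈ Ioo (t₀ - θ * ρ ^ 2) t₀ ×ˢ ball (0 : EuclideanSpace ℝ (Fin 3)) (lam * ρ) ∧ Φ z.1 z.2 < l}
        ≤ ENNReal.ofReal μ₁ * volume (Ioo (t₀ - θ * ρ ^ 2) t₀ ×ˢ ball (0 : EuclideanSpace ℝ (Fin 3)) (lam * ρ)) →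
      ∀ᵐ z ∂(volume.restrict (Ioo (t₀ - θ / 2 * ρ ^ 2) t₀ ×ˢ ball (0 : EuclideanSpace ℝ (Fin 3)) ρ)),
        l / 2 ≤ Φ z.1 z.2 := by
  intro lamlo θlo θhi N hlamlo hlamlo2 hθlo hθlohi
  have hθhi : 0 < θhi := lt_of_lt_of_le hθlo hθlohi
  obtain ⟨C₀, A, hC₀, hA, hM⟩ := hM1 N θhi hθhi
  -- ### constants
  have hV0 : 0 < volume (ball (0 : EuclideanSpace ℝ (Fin 3)) 1) := measure_ball_pos volume 0 one_pos
  have hVtop : volume (ball (0 : EuclideanSpace ℝ (Fin 3)) 1) < ∞ := measure_ball_lt_top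
  obtain ⟨v, hv⟩ : ∃ x : ℝ, x = (volume (ball (0 : EuclideanSpace ℝ (Fin 3)) 1)).toReal := ⟨_, rfl⟩
  have hvpos : 0 < v := by rw [hv]; exact ENNReal.toReal_pos hV0.ne' hVtop.ne
  have hVeq : volume (ball (0 : EuclideanSpace ℝ (Fin 3)) 1) = ENNReal.ofReal v := by
    rw [hv, ENNReal.ofReal_toReal hVtop.ne]
  obtain ⟨c₁, hc₁⟩ : ∃ x : ℝ, x = (lamlo - 1) / 2 * min 1 (3 * θlo / 8) := ⟨_, rfl⟩
  have hc₁pos : 0 < c₁ := by rw [hc₁]; exact mul_pos (by linarith) (lt_min one_pos (by positivity))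
  obtain ⟨G, hG⟩ : ∃ x : ℝ, x = max 1 (C₀ * c₁ ^ (-A)) := ⟨_, rfl⟩
  have hG1 : 1 ≤ G := by rw [hG]; exact le_max_left _ _
  have hGC : C₀ * c₁ ^ (-A) ≤ G := by rw [hG]; exact le_max_right _ _
  obtain ⟨P, hP⟩ : ∃ x : ℝ, x = Real.exp (4 * (3 / 5 * (Real.log G + 4 * A * Real.log 8) / (5 / 2))) := ⟨_, rfl⟩
  have hPpos : 0 < P := by rw [hP]; exact Real.exp_pos _
  obtain ⟨μ₁, hμ₁⟩ : ∃ x : ℝ, x = (2 * P) ^ (-(5 / 2 : ℝ)) / (8 * θhi * v) := ⟨_, rfl⟩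
  have hμ₁pos : 0 < μ₁ := by rw [hμ₁]; positivity
  refine ⟨μ₁, hμ₁pos, ?_⟩
  -- ### data
  intro Φ U k R hSt lam ρ θ t₀ l hlam1 hlam2 hρ hlamρ hθ1 hθ2 ht₀ hbot hl hlk hsmall
  have hSt' := hSt
  obtain ⟨-, hR, hΦm, -, -, hΦ0, -, -, -⟩ := hSt'
  have hρpos : 0 < ρ := lt_of_lt_of_le (by positivity) hρ
  have hθpos : 0 < θ := lt_of_lt_of_le hθlo hθ1
  have hlam0 : 0 ≤ lam - 1 := by linarith
  -- exponents, radii, windows, gaps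
  obtain ⟨q, hq⟩ : ∃ q : ℕ → ℝ, ∀ m, q m = 5 / 2 * (5 / 3 : ℝ) ^ m := ⟨_, fun _ => rfl⟩
  have hqsucc : ∀ m, q (m + 1) = 5 / 3 * q m := fun m => by rw [hq, hq, pow_succ]; ring
  have hq2 : ∀ m, 2 < q m := fun m => by
    rw [hq]; have : (1 : ℝ) ≤ (5 / 3 : ℝ) ^ m := one_le_pow₀ (by norm_num); linarith
  obtain ⟨lamS, hlamS⟩ : ∃ f : ℕ → ℝ, ∀ m, f m = 1 + (lam - 1) * (1 / 2 : ℝ) ^ m := ⟨_, fun _ => rfl⟩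
  obtain ⟨θS, hθS⟩ : ∃ f : ℕ → ℝ, ∀ m, f m = θ / 2 * (1 + (1 / 4 : ℝ) ^ m) := ⟨_, fun _ => rfl⟩
  obtain ⟨dl, hdl⟩ : ∃ f : ℕ → ℝ, ∀ m, f m = (lam - 1) * (1 / 2 : ℝ) ^ (m + 1) := ⟨_, fun _ => rfl⟩
  obtain ⟨dθ, hdθ⟩ : ∃ f : ℕ → ℝ, ∀ m, f m = min 1 (3 * θ / 8 * (1 / 4 : ℝ) ^ m) := ⟨_, fun _ => rfl⟩
  have hpow2 : ∀ m, (0 : ℝ) < (1 / 2 : ℝ) ^ m := fun m => by positivity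
  have hpow4 : ∀ m, (0 : ℝ) < (1 / 4 : ℝ) ^ m := fun m => by positivity
  have hpow2le : ∀ m, (1 / 2 : ℝ) ^ m ≤ 1 := fun m => pow_le_one₀ (by norm_num) (by norm_num)
  have hpow4le : ∀ m, (1 / 4 : ℝ) ^ m ≤ 1 := fun m => pow_le_one₀ (by norm_num) (by norm_num)
  have hlamS1 : ∀ m, 1 ≤ lamS m := fun m => by rw [hlamS]; nlinarith [hpow2 m]
  have hlamSle : ∀ m, lamS m ≤ lam := fun m => by rw [hlamS]; nlinarith [hpow2le m]
  have hθSpos : ∀ m, 0 < θS m := fun m => by rw [hθS]; have := hpow4 m; positivity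
  have hθSle : ∀ m, θS m ≤ θ := fun m => by rw [hθS]; nlinarith [hpow4le m]
  have hθSge : ∀ m, θ / 2 ≤ θS m := fun m => by rw [hθS]; nlinarith [hpow4 m]
  have hdlpos : ∀ m, 0 < dl m := fun m => by
    rw [hdl]; exact mul_pos (by linarith) (by positivity)
  have hdl1 : ∀ m, dl m ≤ 1 := fun m => by
    rw [hdl]; have := pow_le_one₀ (n := m + 1) (by norm_num : (0:ℝ) ≤ 1/2) (by norm_num); nlinarith
  have hdθpos : ∀ m, 0 < dθ m := fun m => by rw [hdθ]; exact lt_min one_pos (by have := hpow4 m; positivity)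
  have hdθ1 : ∀ m, dθ m ≤ 1 := fun m => by rw [hdθ]; exact min_le_left _ _
  have hgapl : ∀ m, lamS (m + 1) + dl m ≤ lamS m := fun m => by
    rw [hlamS, hlamS, hdl, pow_succ]; linarith
  have hgapθ : ∀ m, θS (m + 1) + dθ m ≤ θS m := fun m => by
    rw [hθS, hθS, hdθ, pow_succ]
    have := min_le_right 1 (3 * θ / 8 * (1 / 4 : ℝ) ^ m)
    nlinarith [hpow4 m]
  -- the gap product is `≥ c₁ 8^{-m}`, hence `K_m ≤ G 8^{mA}`
  have hK : ∀ m : ℕ, C₀ * (dl m * dθ m) ^ (-A) ≤ G * (8 : ℝ) ^ ((m : ℝ) * A) := by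
    intro m
    have h8 : (0 : ℝ) < (1 / 8 : ℝ) ^ m := by positivity
    have hprod : c₁ * (1 / 8 : ℝ) ^ m ≤ dl m * dθ m := by
      have h1 : (lamlo - 1) / 2 * (1 / 2 : ℝ) ^ m ≤ dl m := by
        rw [hdl, pow_succ]; nlinarith [hpow2 m]
      have h2 : min 1 (3 * θlo / 8) * (1 / 4 : ℝ) ^ m ≤ dθ m := by
        rw [hdθ]
        rcases le_total 1 (3 * θ / 8 * (1 / 4 : ℝ) ^ m) with hcase | hcase
        · rw [min_eq_left hcase]
          calc min 1 (3 * θlo / 8) * (1 / 4 : ℝ) ^ m ≤ 1 * 1 :=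
                mul_le_mul (min_le_left _ _) (hpow4le m) (hpow4 m).le zero_le_one
            _ = 1 := one_mul 1
        · rw [min_eq_right hcase]
          exact mul_le_mul_of_nonneg_right ((min_le_right _ _).trans (by nlinarith)) (hpow4 m).le
      have e : c₁ * (1 / 8 : ℝ) ^ m = ((lamlo - 1) / 2 * (1 / 2 : ℝ) ^ m) * (min 1 (3 * θlo / 8) * (1 / 4 : ℝ) ^ m) := by
        rw [hc₁, show (1 / 8 : ℝ) = 1 / 2 * (1 / 4) by norm_num, mul_pow]; ring
      rw [e]
      exact mul_le_mul h1 h2 (by have := hpow4 m; positivity) (hdlpos m).le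
    have hcpos : 0 < c₁ * (1 / 8 : ℝ) ^ m := by positivity
    have h1 : (dl m * dθ m) ^ (-A) ≤ (c₁ * (1 / 8 : ℝ) ^ m) ^ (-A) :=
      Real.rpow_le_rpow_of_nonpos hcpos hprod (by linarith)
    have h2 : (c₁ * (1 / 8 : ℝ) ^ m) ^ (-A) = c₁ ^ (-A) * (8 : ℝ) ^ ((m : ℝ) * A) := by
      rw [Real.mul_rpow hc₁pos.le h8.le]
      congr 1
      rw [← Real.rpow_natCast, ← Real.rpow_mul (by norm_num), show (1 / 8 : ℝ) = 8⁻¹ by norm_num,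
        Real.inv_rpow (by norm_num), ← Real.rpow_neg (by norm_num)]
      ring_nf
    calc C₀ * (dl m * dθ m) ^ (-A) ≤ C₀ * (c₁ ^ (-A) * (8 : ℝ) ^ ((m : ℝ) * A)) := by
          rw [← h2]; exact mul_le_mul_of_nonneg_left h1 hC₀
      _ = C₀ * c₁ ^ (-A) * (8 : ℝ) ^ ((m : ℝ) * A) := by ring
      _ ≤ G * (8 : ℝ) ^ ((m : ℝ) * A) := mul_le_mul_of_nonneg_right hGC (by positivity)
  -- ### the integrals `I m` and the iteration
  obtain ⟨I, hI⟩ : ∃ I : ℕ → ℝ≥0∞, ∀ m, I m = ∫⁻ z in Ioo (t₀ - θS m * ρ ^ 2) t₀ ×ˢ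
      ball (0 : EuclideanSpace ℝ (Fin 3)) (lamS m * ρ), ENNReal.ofReal (max (l - Φ z.1 z.2) 0 ^ q m) :=
    ⟨_, fun _ => rfl⟩
  have hW : (0 : ℝ) < ρ ^ 5 := by positivity
  -- the step
  have hstep : ∀ m : ℕ, I (m + 1) ≤
      ENNReal.ofReal (G * (8 : ℝ) ^ ((m : ℝ) * A) * (ρ ^ 5) ^ (-(2 / 3 : ℝ))) * I m ^ (5 / 3 : ℝ) := by
    intro m
    have h := (hM Φ U k R hSt ρ (lamS m) (lamS (m + 1)) (θS m) (θS (m + 1)) (dl m) (dθ m) t₀ l (q m)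
      hρ (hlamS1 (m + 1)) (hgapl m) (by nlinarith [hlamSle m, hρpos.le]) (hdlpos m) (hdl1 m) (hθSpos (m + 1))
      (hgapθ m) ((hθSle m).trans hθ2) (hdθpos m) (hdθ1 m) ht₀ (by nlinarith [hθSle m, hρpos]) hl hlk (hq2 m)).1
    rw [hI (m + 1), hI m, hqsucc m]
    refine h.trans (mul_le_mul_of_nonneg_right (ENNReal.ofReal_le_ofReal ?_) bot_le)
    have e : (ρ ^ 5) ^ (-(2 / 3 : ℝ)) = ρ ^ (-(10 / 3 : ℝ)) := by
      rw [← Real.rpow_natCast, ← Real.rpow_mul hρpos.le]; norm_num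
    rw [e]
    exact mul_le_mul_of_nonneg_right (hK m) (by positivity)
  -- the start
  have hlampos : 0 < lam := by linarith
  have hvolQ : volume (Ioo (t₀ - θ * ρ ^ 2) t₀ ×ˢ ball (0 : EuclideanSpace ℝ (Fin 3)) (lam * ρ))
      ≤ ENNReal.ofReal (8 * θhi * v * ρ ^ 5) := by
    have h3 : Module.finrank ℝ (EuclideanSpace ℝ (Fin 3)) = 3 := by simp
    have h1 : t₀ - (t₀ - θ * ρ ^ 2) = θ * ρ ^ 2 := by ring
    have hlamρ0 : 0 ≤ lam * ρ := by positivity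
    rw [Measure.volume_eq_prod, Measure.prod_prod, Real.volume_Ioo, h1,
      Measure.addHaar_ball volume 0 hlamρ0, h3, hVeq,
      ← ENNReal.ofReal_mul (by positivity), ← ENNReal.ofReal_mul (by positivity)]
    refine ENNReal.ofReal_le_ofReal ?_
    have h2 : lam ^ 3 ≤ 2 ^ 3 := pow_le_pow_left₀ hlampos.le hlam2 3
    have h4 : (lam * ρ) ^ 3 ≤ 8 * ρ ^ 3 := by
      rw [mul_pow]; exact mul_le_mul_of_nonneg_right (by linarith) (by positivity)
    have h5 : θ * ρ ^ 2 ≤ θhi * ρ ^ 2 := mul_le_mul_of_nonneg_right hθ2 (by positivity)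
    calc θ * ρ ^ 2 * ((lam * ρ) ^ 3 * v) ≤ θhi * ρ ^ 2 * (8 * ρ ^ 3 * v) :=
          mul_le_mul h5 (mul_le_mul_of_nonneg_right h4 hvpos.le) (by positivity) (by positivity)
      _ = 8 * θhi * v * ρ ^ 5 := by ring
  have hstart : I 0 ≤ ENNReal.ofReal (ρ ^ 5 * (l ^ (5 / 2 : ℝ) * μ₁ * (8 * θhi * v))) := by
    rw [hI 0]
    have e0 : θS 0 = θ := by rw [hθS, pow_zero]; ring
    have e1 : lamS 0 = lam := by rw [hlamS, pow_zero]; ring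
    have e2 : q 0 = 5 / 2 := by rw [hq, pow_zero, mul_one]
    rw [e0, e1, e2]
    set Q : Set (ℝ × EuclideanSpace ℝ (Fin 3)) := Ioo (t₀ - θ * ρ ^ 2) t₀ ×ˢ
      ball (0 : EuclideanSpace ℝ (Fin 3)) (lam * ρ) with hQ
    have hLm : MeasurableSet {z : ℝ × EuclideanSpace ℝ (Fin 3) | Φ z.1 z.2 < l} :=
      measurableSet_lt hΦm measurable_const
    have hle : ∀ z, ENNReal.ofReal (max (l - Φ z.1 z.2) 0 ^ (5 / 2 : ℝ)) ≤
        {z : ℝ × EuclideanSpace ℝ (Fin 3) | Φ z.1 z.2 < l}.indicator (fun _ => ENNReal.ofReal (l ^ (5 / 2 : ℝ))) z := by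
      intro z
      by_cases hz : Φ z.1 z.2 < l
      · rw [indicator_of_mem (show z ∈ {z : ℝ × EuclideanSpace ℝ (Fin 3) | Φ z.1 z.2 < l} from hz)]
        refine ENNReal.ofReal_le_ofReal (Real.rpow_le_rpow (le_max_right _ _) ?_ (by norm_num))
        exact max_le (by linarith [hΦ0 z.1 z.2]) hl.le
      · rw [indicator_of_notMem (show z ∉ {z : ℝ × EuclideanSpace ℝ (Fin 3) | Φ z.1 z.2 < l} from hz),
          max_eq_right (by linarith), Real.zero_rpow (by norm_num), ENNReal.ofReal_zero]
    calc ∫⁻ z in Q, ENNReal.ofReal (max (l - Φ z.1 z.2) 0 ^ (5 / 2 : ℝ))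
        ≤ ∫⁻ z in Q, {z : ℝ × EuclideanSpace ℝ (Fin 3) | Φ z.1 z.2 < l}.indicator
            (fun _ => ENNReal.ofReal (l ^ (5 / 2 : ℝ))) z := lintegral_mono fun z => hle z
      _ = ENNReal.ofReal (l ^ (5 / 2 : ℝ)) * volume ({z : ℝ × EuclideanSpace ℝ (Fin 3) | Φ z.1 z.2 < l} ∩ Q) := by
          rw [lintegral_indicator hLm, setLIntegral_const, Measure.restrict_apply hLm]
      _ ≤ ENNReal.ofReal (l ^ (5 / 2 : ℝ)) * (ENNReal.ofReal μ₁ * volume Q) := by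
          refine mul_le_mul_of_nonneg_left ?_ bot_le
          refine le_trans (measure_mono fun z hz => ?_) hsmall
          exact ⟨hz.2, hz.1⟩
      _ ≤ ENNReal.ofReal (l ^ (5 / 2 : ℝ)) * (ENNReal.ofReal μ₁ * ENNReal.ofReal (8 * θhi * v * ρ ^ 5)) :=
          mul_le_mul_of_nonneg_left (mul_le_mul_of_nonneg_left hvolQ bot_le) bot_le
      _ = ENNReal.ofReal (ρ ^ 5 * (l ^ (5 / 2 : ℝ) * μ₁ * (8 * θhi * v))) := by
          rw [← ENNReal.ofReal_mul hμ₁pos.le, ← ENNReal.ofReal_mul (by positivity)]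
          congr 1; ring
  have hX₀ : 0 < l ^ (5 / 2 : ℝ) * μ₁ * (8 * θhi * v) := by positivity
  have hiter := moser_iterate_bound hW hX₀ hG1 hA hstart hstep
  -- ### the inner cylinder and the a.e. bound
  set E : Set (ℝ × EuclideanSpace ℝ (Fin 3)) := Ioo (t₀ - θ / 2 * ρ ^ 2) t₀ ×ˢ
    ball (0 : EuclideanSpace ℝ (Fin 3)) ρ with hE
  have hEsub : ∀ m, E ⊆ Ioo (t₀ - θS m * ρ ^ 2) t₀ ×ˢ ball (0 : EuclideanSpace ℝ (Fin 3)) (lamS m * ρ) := by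
    intro m
    refine prod_mono (Ioo_subset_Ioo (by nlinarith [hθSge m, hρpos]) le_rfl) (ball_subset_ball ?_)
    nlinarith [hlamS1 m, hρpos]
  set M : ℝ := P * (l ^ (5 / 2 : ℝ) * μ₁ * (8 * θhi * v)) ^ (1 / (5 / 2 : ℝ)) with hMdef
  have hMpos : 0 < M := by rw [hMdef]; positivity
  have hbound : ∀ m, ∫⁻ z in E, ENNReal.ofReal (max (l - Φ z.1 z.2) 0 ^ q m) ≤
      ENNReal.ofReal (ρ ^ 5 * M ^ q m) := by
    intro m
    refine (lintegral_mono_set (hEsub m)).trans ?_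
    have h := hiter m
    rw [← hP] at h
    rw [← hI m, hMdef, hq m]
    exact h
  have hqge : ∀ m, 1 ≤ q m := fun m => by linarith [hq2 m]
  have hqtop : Tendsto q atTop atTop := by
    have h1 : Tendsto (fun m : ℕ => (5 / 3 : ℝ) ^ m) atTop atTop := tendsto_pow_atTop_atTop_of_one_lt (by norm_num)
    have h2 := h1.const_mul_atTop (by norm_num : (0 : ℝ) < 5 / 2)
    refine h2.congr fun m => ?_
    rw [hq]
  have hu : AEMeasurable (fun z : ℝ × EuclideanSpace ℝ (Fin 3) => max (l - Φ z.1 z.2) 0) (volume.restrict E) :=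
    ((measurable_const.sub hΦm).max measurable_const).aemeasurable
  have hae := ae_le_of_lintegral_rpow_le (μ := volume.restrict E) hu hMpos hqge hqtop hbound
  -- `M = l/2`
  have hM : M = l / 2 := by
    have h2P : 0 < 2 * P := by positivity
    have hX : l ^ (5 / 2 : ℝ) * μ₁ * (8 * θhi * v) = (l * (2 * P)⁻¹) ^ (5 / 2 : ℝ) := by
      rw [hμ₁, mul_assoc, div_mul_cancel₀ _ (by positivity : (8 * θhi * v) ≠ 0),
        Real.mul_rpow hl.le (inv_nonneg.2 h2P.le), Real.inv_rpow h2P.le, Real.rpow_neg h2P.le]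
    rw [hMdef, hX, ← Real.rpow_mul (by positivity), show (5 / 2 : ℝ) * (1 / (5 / 2)) = 1 by norm_num,
      Real.rpow_one]
    field_simp
  filter_upwards [hae] with z hz
  rw [hM] at hz
  have := le_max_left (l - Φ z.1 z.2) 0
  linarith

end Summit.NavierStokesRegularity.NavierStokesRegularity.Theorems.AveragedConeLiouville.NU

end
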